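/-
Copyright (c) 2026 the pub-hodgecm-mathlib formalisation cell (harness21).  Prover seat hodgecm-mathlib-F0P3a-p06 (g26), 2026-09-03.  E1 BRICK LEDGER row 56-B3(55-B) «TAME TWINS
OF THE 55-B DATUM FILES», FILE 1 of 3 (E1 keeper ∕ dealer F0P3a-p03 (g30) 04:24:30Z ∕ 04:25:32Z «= ONE HAND — the whole datum chain B-1∕B-2∕B-3a-RAM»; LEAD F0P3a-plan T15-42 (iii)).
-/
import Summits.HodgeConjecture.HodgeConjecture.Theorems.F0P3cStCharTSHorocyclesAtDatum       -- ★ B-1 p853519 («LH10» LH10-p02 g14): the PLACE-FREE heads are used BY NAME (§1 transport `mem_cmBorelTriple_{N,M,P}_iff`, `mul_comm_of_mem_cmBorelTriple_M`, `isCompact_cmBorelTriple_M_inf`, `mapEdgeSet_actionHom_mul`)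
import Literature.NumberTheory.Automorphic.UnitaryLatticeTreeHorocycleRootStarOfInvolution     -- ★ R1 (F0P2-p01 g27): (T) `exists_mem_torusU_latticeGraphIso_apartmentEnum_eq_add_of_involution` (third matrix entry `(σ ϖ) ^ (-c)`)
import Literature.NumberTheory.Automorphic.UnitaryLatticeTreeHorosphereTransversalOfInvolution -- (T-I) («LH5» LH5-p04 g11): (H8₀) `exists_forall_latticeGraphIso_apartmentEnum_eq_add_of_mem_torusU_of_involution` (place-free)
import Literature.NumberTheory.Automorphic.UnitaryLatticeTreeHorosphereTransversalRamified     -- (T-II) («LH5» LH5-p04 g11): (H5) ∕ (H6₂) ∕ (H7e) ∕ (H7!e) `_of_neg` at a tame ramified place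
import Literature.NumberTheory.Automorphic.UnitaryLatticeTreeGeodesicApartmentOfInvolution    -- ★ B1 FILE 1 p853459 (LH5-p04 g10): `latticeGraph_adj_apartmentEnum_succ_of_involution`, `apartmentEnum_injective_of_involution`
import HarnessLib

/-!
# Row 56-B3(55-B), FILE 1 of 3 — THE TAME TWIN of ★ 55-B-1 «HOROCYCLES AT THE DATUM»: the torus translation `τ`, the compact torus, and the horocycle index of vertices ∕ edges of the
# `U(Φ₃)(L⁺_v)` tree at a TAMELY RAMIFIED place (`σ_w ϖ = −ϖ`, `|2|_w = 1`) — Bruhat–Tits 1972 §10; Serre, *Trees* II.1.1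

Cell `pub/hodgecm-mathlib` (D-0151), crux H413 = `stmt-HodgeConjecture-24833`; lane `--kind proof --supports stmt-HodgeConjecture-24833 --as helper` (THEOREMS ONLY: no definition ∕
instance ∕ notation ∕ named fact ∕ `sorry`; count-neutral: closes no node).  Namespace `Summit.HodgeConjecture.HodgeConjecture.Cruxes.H413.F0P3cStCharTSHorocyclesAtDatumRamified`.
Sibling of ★ `…F0P3cStCharTSHorocyclesAtDatum` (row 55-B-1, p853519) on ★ B3(53)'s pattern: its five `hd`-reading heads re-issued with the unramified datum `hd` replaced POSITIONALLY by
place letters — `_of_involution (hσ hvσ hϖ)` for the three heads whose tree-rooted callees have ANY-involution twins ((T) ★ R1, (H8₀) (T-I), ★ B1 `apartmentEnum_injective_of_involution`),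
`_of_neg (hσ hvσ hϖ hσϖ hres h2 hnorm)` (the seven letters of ★ `isTree_latticeGraph_three_of_neg`, IN ORDER) for the two horocycle-index heads ((H5)(H6₂)(H7e)(H7!e) via (T-II)
`_of_neg`); every other binder VERBATIM (`(w hw) {ϖ} (eA heA) {a} (ha) (A hA0 hA1)`), conclusions VERBATIM except ONE FORCED TOKEN: the model matrix of `τ` is `diag(ϖ, 1, (σ_w ϖ)⁻¹)`
(★ R1: `diag(ϖ, 1, ϖ⁻¹)` is not unitary when `σ_w ϖ = −ϖ`); the edge certificates inside statements print ★ B1's `latticeGraph_adj_apartmentEnum_succ_of_involution` (proof-irrelevant).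
The six heads of ★ B-1 that never read `hd` (§1 transport ×3, `mul_comm_of_mem_cmBorelTriple_M`, `isCompact_cmBorelTriple_M_inf`, `mapEdgeSet_actionHom_mul`) are used BY NAME.
HONEST LABEL: count-neutral datum helper; TAME road GO-LOW (LEAD T15-42); WILD (dyadic) places stay PRINT (`h2 : |2| = 1` is a binder); E1 = PRINT until the keeper's charter test;
h413 OPEN; HC_CM is proved only modulo the 7 printed citations (2 remaining named inputs hLiu418 = stmt-HodgeConjecture-24832, h413 = stmt-HodgeConjecture-24833) until rung 0 closes;
nothing printed is asserted here.

* §1 `exists_mem_cmBorelTriple_M_apartmentEnum_eq_add_two_of_involution` (`τ ∈ T(L⁺_v)`, `eA τ = diag(ϖ, 1, (σ_w ϖ)⁻¹)`, `τ · A j = A (j+2)`),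
  `apartmentEnum_eq_self_of_mem_cmBorelTriple_M_of_apply_zero_of_involution`, `mapEdgeSet_apartmentEnum_eq_self_of_mem_cmBorelTriple_M_of_apply_zero_of_involution`.
* §2 `exists_horocycleIndex_vertices_of_neg` ((X1v)), `exists_horocycleIndex_edges_of_neg` ((X1e)).

## References
* [BruhatTits1972] F. Bruhat, J. Tits, *Groupes réductifs sur un corps local I*, Publ. Math. IHÉS 41 (1972), §10.
* [Serre1980Trees] J.-P. Serre, *Trees* (1980), Ch. II §1.1, Ch. I §6.4.
* [Rogawski1990] J. D. Rogawski, *Automorphic Representations of Unitary Groups in Three Variables*, Ann. of Math. Stud. 123 (1990), §1.10 p. 9, §4.5 p. 45.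
* [Tits1979] J. Tits, *Reductive groups over local fields*, PSPM 33.1 (1979), §2.4.
-/

set_option autoImplicit false
-- the mandated namespace has the single-problem summit's repeated segment (`HodgeConjecture.HodgeConjecture`)
set_option linter.dupNamespace false

noncomputable section

open NumberField IsDedekindDomain
open scoped Valued WithZero Matrix MatrixGroups
open Literature.NumberTheory.Rogawski1990 Literature.NumberTheory.Automorphic Literature.NumberTheory.Automorphic.UnitaryGroup
open Literature.NumberTheory.Automorphic.UnitaryLatticeTree Literature.NumberTheory.Automorphic.HermitianLattice

namespace Summit.HodgeConjecture.HodgeConjecture.Cruxes.H413.F0P3cStCharTSHorocyclesAtDatumRamified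

open Summit.HodgeConjecture.HodgeConjecture.Cruxes.H413.F0P3cStCharTSHorocyclesAtDatum

/-! ## §1 The torus letters at the datum, any isometric involution (`_of_involution`) -/

section Torus

variable (L : Type) [Field L] [NumberField L] [IsCMField L] (v : HeightOneSpectrum (𝓞 ↥(maximalRealSubfield L)))
  (w : PlacesOver L v) (hw : IsCMField.complexConj L • w.1 = w.1) {ϖ : w.1.adicCompletion L}
  (eA : Gqs L v ≃ₜ* ↥(unitaryGroupOfForm (galAdicCompletionMap (L := L) (IsCMField.complexConj L) hw) ((StdForm.antidiagonal 3).over (w.1.adicCompletion L))))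
  (heA : ∀ g : Gqs L v,
    ((eA g : ↥(unitaryGroupOfForm (galAdicCompletionMap (L := L) (IsCMField.complexConj L) hw) ((StdForm.antidiagonal 3).over (w.1.adicCompletion L)))) :
        GL (Fin 3) (w.1.adicCompletion L)) =
      ((localNonsplitEquiv (IsCMField.complexConj L) (qsForm L) (IsCMField.complexConj_ne_one L) w hw g :
        ↥(unitaryGroupOfForm (galAdicCompletionMap (L := L) (IsCMField.complexConj L) hw) (placeForm (qsForm L) w.1))) : GL (Fin 3) (w.1.adicCompletion L)))
  {a : Gqs L v →* ((latticeGraph (galAdicCompletionMap (L := L) (IsCMField.complexConj L) hw) ϖ ((StdForm.antidiagonal 3).over (w.1.adicCompletion L))) ≃g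
    (latticeGraph (galAdicCompletionMap (L := L) (IsCMField.complexConj L) hw) ϖ ((StdForm.antidiagonal 3).over (w.1.adicCompletion L))))}
  (ha : ∀ g, a g = latticeGraphIso (galAdicCompletionMap (L := L) (IsCMField.complexConj L) hw) ϖ ((StdForm.antidiagonal 3).over (w.1.adicCompletion L)) (eA g))
  (A : ℤ → {M : Submodule 𝒪[(w.1.adicCompletion L)] (Fin 3 → (w.1.adicCompletion L)) //
    IsVertex (galAdicCompletionMap (L := L) (IsCMField.complexConj L) hw) ϖ ((StdForm.antidiagonal 3).over (w.1.adicCompletion L)) M})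
  (hA0 : ∀ c : ℤ, (A (2 * c)).1 = latt (Matrix.diagonal ![ϖ ^ c, (1 : w.1.adicCompletion L), ϖ ^ (-c)]))
  (hA1 : ∀ c : ℤ, (A (2 * c + 1)).1 = latt (Matrix.diagonal ![ϖ ^ (c + 1), (1 : w.1.adicCompletion L), ϖ ^ (-c)]))

include heA ha hA0 hA1 in
/-- **THE TORUS TRANSLATION AT THE DATUM, any isometric involution**: there is `τ ∈ T(L⁺_v) = (cmBorelTriple L 3 v).M` with model matrix `eA τ = diag(ϖ, 1, (σ_w ϖ)⁻¹)` translating the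
enumerated apartment by two: `τ · A j = A (j + 2)` (★ R1 (T) at `c = 1`, pulled back along `eA`).  Twin of ★ `exists_mem_cmBorelTriple_M_apartmentEnum_eq_add_two` with the ONE forced
token `(σ_w ϖ)⁻¹` in the third matrix entry (`= ϖ⁻¹` iff `σ_w ϖ = ϖ`; `= −ϖ⁻¹` at a tame ramified place). [cite: Rogawski1990, §1.10 p. 9] [cite: BruhatTits1972, §10] -/
theorem exists_mem_cmBorelTriple_M_apartmentEnum_eq_add_two_of_involution
    (hσ : ∀ x, (galAdicCompletionMap (L := L) (IsCMField.complexConj L) hw) ((galAdicCompletionMap (L := L) (IsCMField.complexConj L) hw) x) = x)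
    (hvσ : ∀ x, Valued.v ((galAdicCompletionMap (L := L) (IsCMField.complexConj L) hw) x) = Valued.v x) (hϖ : Valued.v ϖ = WithZero.exp (-1 : ℤ))
    :
    ∃ τ : Gqs L v, τ ∈ (cmBorelTriple L 3 v : ParabolicTriple (Gqs L v)).M ∧
      (((eA τ : ↥(unitaryGroupOfForm (galAdicCompletionMap (L := L) (IsCMField.complexConj L) hw) ((StdForm.antidiagonal 3).over (w.1.adicCompletion L)))) :
          GL (Fin 3) (w.1.adicCompletion L)) : Matrix (Fin 3) (Fin 3) (w.1.adicCompletion L)) =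
        Matrix.diagonal ![ϖ, 1, ((galAdicCompletionMap (L := L) (IsCMField.complexConj L) hw) ϖ)⁻¹] ∧
      ∀ j : ℤ, a τ (A j) = A (j + 2) := by
  obtain ⟨t, htT, htm, htA⟩ := exists_mem_torusU_latticeGraphIso_apartmentEnum_eq_add_of_involution hσ hvσ hϖ A hA0 hA1 1
  refine ⟨eA.symm t, ?_, ?_, fun j => ?_⟩
  · rw [mem_cmBorelTriple_M_iff L v w hw eA heA, ContinuousMulEquiv.apply_symm_apply]; exact htT
  · rw [ContinuousMulEquiv.apply_symm_apply, htm, zpow_one, zpow_neg, zpow_one]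
  · rw [ha, ContinuousMulEquiv.apply_symm_apply, htA, mul_one]

include heA ha hA0 hA1 in
/-- **A TORUS ELEMENT FIXING ONE APARTMENT VERTEX FIXES THE WHOLE APARTMENT**, any isometric involution: `c ∈ T(L⁺_v)`, `c · A 0 = A 0` ⇒ `c · A j = A j` ((T-I) (H8₀)
`_of_involution`: `eA c` translates the apartment by some `2c′`; `A (2c′) = A 0` forces `c′ = 0` by ★ B1 `apartmentEnum_injective_of_involution`).  Twin of ★
`apartmentEnum_eq_self_of_mem_cmBorelTriple_M_of_apply_zero`, conclusion VERBATIM. [cite: BruhatTits1972, §10] [cite: Serre1980Trees, II.1.1; I.6.4] [cite: Rogawski1990, §1.10 p. 9] -/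
theorem apartmentEnum_eq_self_of_mem_cmBorelTriple_M_of_apply_zero_of_involution
    (hσ : ∀ x, (galAdicCompletionMap (L := L) (IsCMField.complexConj L) hw) ((galAdicCompletionMap (L := L) (IsCMField.complexConj L) hw) x) = x)
    (hvσ : ∀ x, Valued.v ((galAdicCompletionMap (L := L) (IsCMField.complexConj L) hw) x) = Valued.v x) (hϖ : Valued.v ϖ = WithZero.exp (-1 : ℤ))
    {c : Gqs L v} (hcM : c ∈ (cmBorelTriple L 3 v : ParabolicTriple (Gqs L v)).M)
    (hc0 : a c (A 0) = A 0) (j : ℤ) : a c (A j) = A j := by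
  obtain ⟨c', hshift, -⟩ := exists_forall_latticeGraphIso_apartmentEnum_eq_add_of_mem_torusU_of_involution hσ hvσ hϖ A hA0 hA1
    ((mem_cmBorelTriple_M_iff L v w hw eA heA c).1 hcM)
  have h0 := hshift 0
  rw [← ha, hc0, zero_add] at h0
  have hc' : c' = 0 := by have := apartmentEnum_injective_of_involution hϖ A hA0 hA1 h0; omega
  rw [ha, hshift j, hc', mul_zero, add_zero]

include heA ha in
/-- The apartment EDGES `{A j, A (j+1)}` are fixed (as elements of `edgeSet`) by a torus element fixing `A 0`, any isometric involution (edge certificate ★ B1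
`latticeGraph_adj_apartmentEnum_succ_of_involution`, proof-irrelevant).  Twin of ★ `mapEdgeSet_apartmentEnum_eq_self_of_mem_cmBorelTriple_M_of_apply_zero`.
[cite: BruhatTits1972, §10] [cite: Serre1980Trees, II.1.1] -/
theorem mapEdgeSet_apartmentEnum_eq_self_of_mem_cmBorelTriple_M_of_apply_zero_of_involution
    (hσ : ∀ x, (galAdicCompletionMap (L := L) (IsCMField.complexConj L) hw) ((galAdicCompletionMap (L := L) (IsCMField.complexConj L) hw) x) = x)
    (hvσ : ∀ x, Valued.v ((galAdicCompletionMap (L := L) (IsCMField.complexConj L) hw) x) = Valued.v x) (hϖ : Valued.v ϖ = WithZero.exp (-1 : ℤ))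
    {c : Gqs L v} (hcM : c ∈ (cmBorelTriple L 3 v : ParabolicTriple (Gqs L v)).M)
    (hc0 : a c (A 0) = A 0) (j : ℤ) :
    (a c).mapEdgeSet ⟨s(A j, A (j + 1)), (SimpleGraph.mem_edgeSet _).2 (latticeGraph_adj_apartmentEnum_succ_of_involution hσ hvσ hϖ A hA0 hA1 j)⟩ =
      ⟨s(A j, A (j + 1)), (SimpleGraph.mem_edgeSet _).2 (latticeGraph_adj_apartmentEnum_succ_of_involution hσ hvσ hϖ A hA0 hA1 j)⟩ := by
  apply Subtype.ext
  change Sym2.map (a c) s(A j, A (j + 1)) = s(A j, A (j + 1))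
  rw [Sym2.map_mk, apartmentEnum_eq_self_of_mem_cmBorelTriple_M_of_apply_zero_of_involution L v w hw eA heA ha A hA0 hA1 hσ hvσ hϖ hcM hc0 j,
    apartmentEnum_eq_self_of_mem_cmBorelTriple_M_of_apply_zero_of_involution L v w hw eA heA ha A hA0 hA1 hσ hvσ hϖ hcM hc0 (j + 1)]

end Torus

/-! ## §2 THE HOROCYCLE INDEX AT THE DATUM at a tamely ramified place (`_of_neg`: `σ_w ϖ = −ϖ`, `|2|_w = 1`) -/

section Horocycle

variable (L : Type) [Field L] [NumberField L] [IsCMField L] (v : HeightOneSpectrum (𝓞 ↥(maximalRealSubfield L)))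
  (w : PlacesOver L v) (hw : IsCMField.complexConj L • w.1 = w.1) {ϖ : w.1.adicCompletion L}
  (eA : Gqs L v ≃ₜ* ↥(unitaryGroupOfForm (galAdicCompletionMap (L := L) (IsCMField.complexConj L) hw) ((StdForm.antidiagonal 3).over (w.1.adicCompletion L))))
  (heA : ∀ g : Gqs L v,
    ((eA g : ↥(unitaryGroupOfForm (galAdicCompletionMap (L := L) (IsCMField.complexConj L) hw) ((StdForm.antidiagonal 3).over (w.1.adicCompletion L)))) :
        GL (Fin 3) (w.1.adicCompletion L)) =
      ((localNonsplitEquiv (IsCMField.complexConj L) (qsForm L) (IsCMField.complexConj_ne_one L) w hw g :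
        ↥(unitaryGroupOfForm (galAdicCompletionMap (L := L) (IsCMField.complexConj L) hw) (placeForm (qsForm L) w.1))) : GL (Fin 3) (w.1.adicCompletion L)))
  {a : Gqs L v →* ((latticeGraph (galAdicCompletionMap (L := L) (IsCMField.complexConj L) hw) ϖ ((StdForm.antidiagonal 3).over (w.1.adicCompletion L))) ≃g
    (latticeGraph (galAdicCompletionMap (L := L) (IsCMField.complexConj L) hw) ϖ ((StdForm.antidiagonal 3).over (w.1.adicCompletion L))))}
  (ha : ∀ g, a g = latticeGraphIso (galAdicCompletionMap (L := L) (IsCMField.complexConj L) hw) ϖ ((StdForm.antidiagonal 3).over (w.1.adicCompletion L)) (eA g))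
  (A : ℤ → {M : Submodule 𝒪[(w.1.adicCompletion L)] (Fin 3 → (w.1.adicCompletion L)) //
    IsVertex (galAdicCompletionMap (L := L) (IsCMField.complexConj L) hw) ϖ ((StdForm.antidiagonal 3).over (w.1.adicCompletion L)) M})
  (hA0 : ∀ c : ℤ, (A (2 * c)).1 = latt (Matrix.diagonal ![ϖ ^ c, (1 : w.1.adicCompletion L), ϖ ^ (-c)]))
  (hA1 : ∀ c : ℤ, (A (2 * c + 1)).1 = latt (Matrix.diagonal ![ϖ ^ (c + 1), (1 : w.1.adicCompletion L), ϖ ^ (-c)]))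

include heA ha hA0 hA1 in
/-- **(X1v) THE HOROCYCLE INDEX OF A VERTEX AT THE DATUM at a tame ramified place**: functions `idx : 𝓥 → ℤ`, `tr : 𝓥 → N(L⁺_v)` with `tr x · A (idx x) = x`, `idx` invariant under
`N(L⁺_v)` and `idx (A j) = j` ((T-II) (H5)(H6₂) `_of_neg` pulled back along `eA`).  Twin of ★ `exists_horocycleIndex_vertices`, conclusion VERBATIM. [cite: BruhatTits1972, §10]
[cite: Serre1980Trees, II.1.1] [cite: Rogawski1990, §4.5 p. 45] [cite: Tits1979, §2.4] -/
theorem exists_horocycleIndex_vertices_of_neg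
    (hσ : ∀ x, (galAdicCompletionMap (L := L) (IsCMField.complexConj L) hw) ((galAdicCompletionMap (L := L) (IsCMField.complexConj L) hw) x) = x)
    (hvσ : ∀ x, Valued.v ((galAdicCompletionMap (L := L) (IsCMField.complexConj L) hw) x) = Valued.v x) (hϖ : Valued.v ϖ = WithZero.exp (-1 : ℤ))
    (hσϖ : (galAdicCompletionMap (L := L) (IsCMField.complexConj L) hw) ϖ = -ϖ)
    (hres : ∀ x : (w.1.adicCompletion L), Valued.v x ≤ 1 → Valued.v ((galAdicCompletionMap (L := L) (IsCMField.complexConj L) hw) x - x) < 1)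
    (h2 : Valued.v (2 : (w.1.adicCompletion L)) = 1)
    (hnorm : ∀ u : (w.1.adicCompletion L), (galAdicCompletionMap (L := L) (IsCMField.complexConj L) hw) u = u → Valued.v (u - 1) < 1 →
    ∃ z : (w.1.adicCompletion L), z * (galAdicCompletionMap (L := L) (IsCMField.complexConj L) hw) z = u ∧ Valued.v (z - 1) ≤ Valued.v (u - 1))
    :
    ∃ (idx : {M : Submodule 𝒪[(w.1.adicCompletion L)] (Fin 3 → (w.1.adicCompletion L)) //
        IsVertex (galAdicCompletionMap (L := L) (IsCMField.complexConj L) hw) ϖ ((StdForm.antidiagonal 3).over (w.1.adicCompletion L)) M} → ℤ)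
      (tr : {M : Submodule 𝒪[(w.1.adicCompletion L)] (Fin 3 → (w.1.adicCompletion L)) //
        IsVertex (galAdicCompletionMap (L := L) (IsCMField.complexConj L) hw) ϖ ((StdForm.antidiagonal 3).over (w.1.adicCompletion L)) M} → Gqs L v),
      (∀ x, tr x ∈ (cmBorelTriple L 3 v : ParabolicTriple (Gqs L v)).N) ∧ (∀ x, a (tr x) (A (idx x)) = x) ∧
      (∀ n ∈ (cmBorelTriple L 3 v : ParabolicTriple (Gqs L v)).N, ∀ x, idx (a n x) = idx x) ∧ (∀ j : ℤ, idx (A j) = j) := by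
  have hex := fun x => exists_mem_unipotentU_latticeGraphIso_apartmentEnum_eq_of_neg hσ hvσ hϖ hσϖ hres h2 hnorm A hA0 hA1 x
  choose n hn j hj using hex
  refine ⟨j, fun x => eA.symm (n x), fun x => ?_, fun x => ?_, fun g hg x => ?_, fun i => ?_⟩
  · rw [mem_cmBorelTriple_N_iff L v w hw eA heA, ContinuousMulEquiv.apply_symm_apply]; exact hn x
  · rw [ha, ContinuousMulEquiv.apply_symm_apply]; exact hj x
  · have hg' := (mem_cmBorelTriple_N_iff L v w hw eA heA g).1 hg
    have h1 : latticeGraphIso (galAdicCompletionMap (L := L) (IsCMField.complexConj L) hw) ϖ ((StdForm.antidiagonal 3).over (w.1.adicCompletion L))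
        (eA g * n x) (A (j x)) = a g x := by
      rw [latticeGraphIso_mul_apply, hj x, ha]
    exact eq_of_mem_unipotentU_of_latticeGraphIso_apartmentEnum_eq₂_of_neg hσ hvσ hϖ hσϖ hres h2 hnorm A hA0 hA1 (hn (a g x)) (mul_mem hg' (hn x))
      ((hj (a g x)).trans h1.symm)
  · exact eq_of_mem_unipotentU_of_latticeGraphIso_apartmentEnum_eq₂_of_neg hσ hvσ hϖ hσϖ hres h2 hnorm A hA0 hA1 (hn (A i)) (one_mem _)
      ((hj (A i)).trans (latticeGraphIso_one_apply _).symm)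

include heA ha hA0 hA1 in
set_option maxHeartbeats 1600000 in  -- statement-level `whnf` on the datum edge type `⟨s(A j, A (j+1)), _⟩` over the CM carriers (= ★ B-1's budget, measured there)
/-- **(X1e) THE HOROCYCLE INDEX OF AN EDGE AT THE DATUM at a tame ramified place**: `idx₁ : 𝓔 → ℤ`, `tr₁ : 𝓔 → N(L⁺_v)` with `tr₁ d · {A (idx₁ d), A (idx₁ d + 1)} = d`, `idx₁`
invariant under `N(L⁺_v)`, `idx₁ {A j, A (j+1)} = j` ((T-II) (H7e)(H7!e) `_of_neg` along `eA`; edge certificates ★ B1 `…_succ_of_involution`, proof-irrelevant).  Twin of ★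
`exists_horocycleIndex_edges`, conclusion VERBATIM. [cite: BruhatTits1972, §10] [cite: Serre1980Trees, II.1.1] [cite: Tits1979, §2.4] -/
theorem exists_horocycleIndex_edges_of_neg
    (hσ : ∀ x, (galAdicCompletionMap (L := L) (IsCMField.complexConj L) hw) ((galAdicCompletionMap (L := L) (IsCMField.complexConj L) hw) x) = x)
    (hvσ : ∀ x, Valued.v ((galAdicCompletionMap (L := L) (IsCMField.complexConj L) hw) x) = Valued.v x) (hϖ : Valued.v ϖ = WithZero.exp (-1 : ℤ))
    (hσϖ : (galAdicCompletionMap (L := L) (IsCMField.complexConj L) hw) ϖ = -ϖ)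
    (hres : ∀ x : (w.1.adicCompletion L), Valued.v x ≤ 1 → Valued.v ((galAdicCompletionMap (L := L) (IsCMField.complexConj L) hw) x - x) < 1)
    (h2 : Valued.v (2 : (w.1.adicCompletion L)) = 1)
    (hnorm : ∀ u : (w.1.adicCompletion L), (galAdicCompletionMap (L := L) (IsCMField.complexConj L) hw) u = u → Valued.v (u - 1) < 1 →
    ∃ z : (w.1.adicCompletion L), z * (galAdicCompletionMap (L := L) (IsCMField.complexConj L) hw) z = u ∧ Valued.v (z - 1) ≤ Valued.v (u - 1))
    :
    ∃ (idx₁ : (latticeGraph (galAdicCompletionMap (L := L) (IsCMField.complexConj L) hw) ϖ ((StdForm.antidiagonal 3).over (w.1.adicCompletion L))).edgeSet → ℤ)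
      (tr₁ : (latticeGraph (galAdicCompletionMap (L := L) (IsCMField.complexConj L) hw) ϖ ((StdForm.antidiagonal 3).over (w.1.adicCompletion L))).edgeSet → Gqs L v),
      (∀ d, tr₁ d ∈ (cmBorelTriple L 3 v : ParabolicTriple (Gqs L v)).N) ∧
      (∀ d, (a (tr₁ d)).mapEdgeSet ⟨s(A (idx₁ d), A (idx₁ d + 1)), (SimpleGraph.mem_edgeSet _).2 (latticeGraph_adj_apartmentEnum_succ_of_involution hσ hvσ hϖ A hA0 hA1 (idx₁ d))⟩ = d) ∧
      (∀ n ∈ (cmBorelTriple L 3 v : ParabolicTriple (Gqs L v)).N, ∀ d, idx₁ ((a n).mapEdgeSet d) = idx₁ d) ∧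
      (∀ j : ℤ, idx₁ ⟨s(A j, A (j + 1)), (SimpleGraph.mem_edgeSet _).2 (latticeGraph_adj_apartmentEnum_succ_of_involution hσ hvσ hϖ A hA0 hA1 j)⟩ = j) := by
  have hex := fun d => exists_mem_unipotentU_mapEdgeSet_apartmentEnum_eq_of_neg hσ hvσ hϖ hσϖ hres h2 hnorm A hA0 hA1 d
  choose n hn j hj using hex
  refine ⟨j, fun d => eA.symm (n d), fun d => ?_, fun d => ?_, fun g hg d => ?_, fun i => ?_⟩
  · rw [mem_cmBorelTriple_N_iff L v w hw eA heA, ContinuousMulEquiv.apply_symm_apply]; exact hn d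
  · rw [ha, ContinuousMulEquiv.apply_symm_apply]; exact hj d
  · have hg' := (mem_cmBorelTriple_N_iff L v w hw eA heA g).1 hg
    have h1 : (latticeGraphIso (galAdicCompletionMap (L := L) (IsCMField.complexConj L) hw) ϖ ((StdForm.antidiagonal 3).over (w.1.adicCompletion L))
        (eA g * n d)).mapEdgeSet ⟨s(A (j d), A (j d + 1)), (SimpleGraph.mem_edgeSet _).2 (latticeGraph_adj_apartmentEnum_succ_of_involution hσ hvσ hϖ A hA0 hA1 (j d))⟩ = (a g).mapEdgeSet d := by
      rw [← ContinuousMulEquiv.apply_symm_apply eA (n d), ← map_mul, ← ha, mapEdgeSet_actionHom_mul L v w hw eA ha, ha (eA.symm (n d)),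
        ContinuousMulEquiv.apply_symm_apply, hj d]
    exact eq_of_mem_unipotentU_of_mapEdgeSet_apartmentEnum_eq_of_neg hσ hvσ hϖ hσϖ hres h2 hnorm A hA0 hA1 (hn ((a g).mapEdgeSet d)) (mul_mem hg' (hn d))
      ((hj ((a g).mapEdgeSet d)).trans h1.symm)
  · refine eq_of_mem_unipotentU_of_mapEdgeSet_apartmentEnum_eq_of_neg hσ hvσ hϖ hσϖ hres h2 hnorm A hA0 hA1 (hn _) (one_mem _) ((hj _).trans ?_)
    apply Subtype.ext
    change _ = Sym2.map (latticeGraphIso (galAdicCompletionMap (L := L) (IsCMField.complexConj L) hw) ϖ ((StdForm.antidiagonal 3).over (w.1.adicCompletion L)) 1) s(A i, A (i + 1))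
    rw [Sym2.map_mk, latticeGraphIso_one_apply, latticeGraphIso_one_apply]

end Horocycle

end Summit.HodgeConjecture.HodgeConjecture.Cruxes.H413.F0P3cStCharTSHorocyclesAtDatumRamified

end
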